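import Literature.RepresentationTheory.FiniteGroups.PermutationFunctionsCycleStep
import Literature.NumberTheory.GaloisRepresentations.ContinuousShapiroOpenCoinducedTensor
import Mathlib.GroupTheory.SpecificGroups.Cyclic.Basic
import HarnessLib

/-!
# The `p`-part step of Tate's Euler–Poincaré characteristic argument at the ambient level:
# `ψ (M ⊗ ℤ[Q/C]/p) = p • ψ (M ⊗ ℤ[Q/H]/p)` for `C ≤ H ≤ Q`, `H` cyclic, `[H : C] = p`
# (Milne ADT I Lemma 2.10 / proof of Thm. 5.1; Serre, *Local Fields* IX §1)

Topic `RepresentationTheory/FiniteGroups`; namespace `Literature.RepresentationTheory.FiniteGroups`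
(sub-namespace `IndexPStep`).  THEOREMS ONLY (no definition, no named fact, no `sorry`, no
instance).  Sequel of `PermutationFunctionsCycleStep` (the abstract `p`-cycle step
`additive_funRepr_eq_smul_of_cycle`) and of `NilpotentOperatorKernelFiltration`.

Milne, *Arithmetic Duality Theorems* (2006), proof of I Thm. 5.1 (p. 70) with Lemma 2.10 (p. 32):
after Artin induction one may "assume that `Ḡ` is a cyclic group", and the cyclic groups are
brought to order prime to `p` because a cyclic `p`-group contributes through
`𝔽_p[ℤ/p] = 𝔽_p[t]/(t-1)^p`, all of whose composition factors are trivial (Serre, *Local Fields*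
IX §1 Thm. 2, Cor.).  The lane «TATE-EPC-TC» (road memo `TATE-EPC-TC-ROAD`, evidence #54 on
stmt-BirchSwinnertonDyer-19032, brick B9) runs the reduction with ONE additive invariant `ψ` of
finite `p`-torsion `ℤ[Q]`-modules for the AMBIENT finite group `Q`, so the `p`-part step is needed
as: for `C ≤ H ≤ Q` with `H` CYCLIC and `[H : C] = p`, and `M` a finite `ℤ[Q]`-module killed by `p`,

  `ψ (Maps(Q/C, M)) = p • ψ (Maps(Q/H, M))`, equivalently `ψ (M ⊗ ℤ[Q/C]/p) = p • ψ (M ⊗ ℤ[Q/H]/p)`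

(diagonal actions): right translation `R : qC ↦ qhC` by a generator `h` of `H/C` (every subgroup
of the cyclic `H` is normal) is a `Q`-equivariant permutation of `Q/C` whose orbits are the fibres
of `Q/C → Q/H`, each an `R`-cycle of length exactly `p` — the hypotheses of the abstract step.

* §1 `exists_generator_mod` (a generator of `H/C` and the coset decomposition `H = ⋃ hⁱC`),
  **`additive_funRepr_quotient_eq_smul`** (function currency);
* §2 **`additive_tprod_permQuot_eq_funRepr`**, **`additive_tprod_permQuot_eq_smul`** (the tensor
  currency `Representation.permQuot` of `ContinuousShapiroOpenCoinducedTensor`, in which the lane's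
  Artin identity `ArtinTwist.twist_reduction_artinSets_eq` is stated).

## References
* J. S. Milne, *Arithmetic Duality Theorems*, 2nd ed. (2006), I Lemma 2.10 (p. 32), proof of
  Thm. 5.1 (p. 70), Lemma 5.4 (b). [MilneADT2006]
* J.-P. Serre, *Local Fields*, GTM 67 (1979), IX §1 Thm. 2 and Corollary. [Serre1979]
* J.-P. Serre, *Linear Representations of Finite Groups*, GTM 42 (1977), §3.3, §15.2 Thm. 32.
  [SerreLinearRepresentations1977]
-/

noncomputable section

namespace Literature.RepresentationTheory.FiniteGroups

namespace IndexPStep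

open Function LinearMap Submodule StableLatticeReduction
open Literature.Algebra.Homology (funRepr funRepr_apply)
open Literature.NumberTheory.GaloisRepresentations

variable {Q : Type} [Group Q] {A : Type*} [AddCommGroup A] {p : ℕ} [hp : Fact p.Prime]

/-! ### §1. The coset instance: `C ≤ H ≤ Q`, `H` cyclic, `[H : C] = p` -/

section Coset

variable {M : Type} [AddCommGroup M] (σ : Representation ℤ Q M)
variable (ψ : ∀ ⦃X : Type⦄ [AddCommGroup X] [Module ℤ X], Representation ℤ Q X → A)
  (hψ : ∀ ⦃X Y Z : Type⦄ [AddCommGroup X] [Module ℤ X] [AddCommGroup Y] [Module ℤ Y]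
    [AddCommGroup Z] [Module ℤ Z] (ρX : Representation ℤ Q X) (ρY : Representation ℤ Q Y)
    (ρZ : Representation ℤ Q Z) (f : X →ₗ[ℤ] Y) (g : Y →ₗ[ℤ] Z),
    (∀ s x, f (ρX s x) = ρY s (f x)) → (∀ s y, g (ρY s y) = ρZ s (g y)) →
    Injective f → Surjective g → LinearMap.range f = LinearMap.ker g → Finite Y →
    (∀ y : Y, (p : ℤ) • y = 0) → ψ ρY = ψ ρX + ψ ρZ)

omit hp in
/-- In a cyclic group every subgroup is normal. [folklore] -/
private theorem normal_subgroupOf_of_isCyclic {C H : Subgroup Q} (hH : IsCyclic H) :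
    (C.subgroupOf H).Normal := by
  letI : CommGroup H := IsCyclic.commGroup
  exact ⟨fun n hn g => by rwa [mul_comm g n, mul_inv_cancel_right]⟩

/-- **A generator of `H/C`**: for `C ≤ H` with `H` cyclic and `[H : C] = p` there is `h ∈ H` with
`h^p ∈ C`, `h^i ∉ C` for `0 < i < p`, and `H = ⋃_{i<p} h^i C`. [cite: Serre1979, IX §1] -/
theorem exists_generator_mod {C H : Subgroup Q} (hH : IsCyclic H) (hidx : C.relIndex H = p) :
    ∃ h ∈ H, h ^ p ∈ C ∧ (∀ i, 0 < i → i < p → h ^ i ∉ C) ∧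
      ∀ d ∈ H, ∃ i c, c ∈ C ∧ d = h ^ i * c := by
  haveI := normal_subgroupOf_of_isCyclic (C := C) hH
  obtain ⟨g, hg⟩ := IsCyclic.exists_generator (α := H)
  have hgC : (g : Q) ∉ C := by
    intro hgC
    have hle : H ≤ C := fun x hx => by
      obtain ⟨k, hk⟩ := Subgroup.mem_zpowers_iff.1 (hg ⟨x, hx⟩)
      have : x = ((g : Q)) ^ k := by
        rw [← Subgroup.coe_zpow, hk]
      rw [this]
      exact C.zpow_mem hgC k
    have : C.relIndex H = 1 := Subgroup.relIndex_eq_one.2 hle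
    rw [hidx] at this
    exact hp.out.one_lt.ne' this
  have hgp : (g : Q) ^ p ∈ C := by
    have := Subgroup.pow_index_mem (C.subgroupOf H) g
    rw [Subgroup.mem_subgroupOf, Subgroup.coe_pow] at this
    rw [← hidx]; exact this
  -- the order of `g` mod `C` is `p`
  have hord : orderOf (QuotientGroup.mk (s := C.subgroupOf H) g) = p := by
    refine orderOf_eq_prime ?_ ?_
    · rw [← QuotientGroup.mk_pow, QuotientGroup.eq_one_iff, Subgroup.mem_subgroupOf, Subgroup.coe_pow]
      exact hgp
    · intro h1
      rw [QuotientGroup.eq_one_iff, Subgroup.mem_subgroupOf] at h1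
      exact hgC h1
  refine ⟨g, g.2, hgp, fun i hi hip hgi => ?_, fun d hd => ?_⟩
  · have h1 : (QuotientGroup.mk (s := C.subgroupOf H) g) ^ i = 1 := by
      rw [← QuotientGroup.mk_pow, QuotientGroup.eq_one_iff, Subgroup.mem_subgroupOf, Subgroup.coe_pow]
      exact hgi
    have hdvd := orderOf_dvd_of_pow_eq_one h1
    rw [hord] at hdvd
    exact absurd hip (not_lt.2 (Nat.le_of_dvd hi hdvd))
  · obtain ⟨k, hk⟩ := Subgroup.mem_zpowers_iff.1 (hg ⟨d, hd⟩)
    -- `d = g^k = g^(k mod p) · (g^p)^(k div p)`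
    refine ⟨(k % p).toNat, (g : Q) ^ ((p : ℤ) * (k / p)), ?_, ?_⟩
    · rw [zpow_mul, zpow_natCast]; exact C.zpow_mem hgp _
    have hk' : d = (g : Q) ^ k := by rw [← Subgroup.coe_zpow, hk]
    have hmod : (((k % p).toNat : ℕ) : ℤ) = k % p :=
      Int.toNat_of_nonneg (Int.emod_nonneg _ (by exact_mod_cast hp.out.ne_zero))
    rw [hk', ← zpow_natCast, hmod, ← zpow_add, Int.emod_add_mul_ediv]

include hψ in
/-- **The `p`-part step, function currency**: for `C ≤ H ≤ Q` with `H` cyclic, `[H : C] = p`, `Q/C`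
finite, and `M` a finite `ℤ[Q]`-module killed by `p`,
`ψ (Maps(Q/C, M)) = p • ψ (Maps(Q/H, M))` (diagonal actions `(g f)(x) = g f(g⁻¹ x)`).
[cite: MilneADT2006, I Lemma 2.10 (p. 32) and proof of Thm. 5.1 (p. 70)]
[cite: Serre1979, IX §1 Thm. 2, Corollary] -/
theorem additive_funRepr_quotient_eq_smul [Finite M] (hM : ∀ m : M, (p : ℤ) • m = 0)
    {C H : Subgroup Q} [Finite (Q ⧸ C)] [Finite (Q ⧸ H)] (hH : IsCyclic H) (hCH : C ≤ H)
    (hidx : C.relIndex H = p) :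
    ψ (funRepr σ (Q ⧸ C)) = p • ψ (funRepr σ (Q ⧸ H)) := by
  obtain ⟨h, hh, hhp, hhi, hcos⟩ := exists_generator_mod hH hidx
  haveI := normal_subgroupOf_of_isCyclic (C := C) hH
  -- commutativity inside `H`
  have hcomm : ∀ c ∈ C, h⁻¹ * c * h = c := fun c hc => by
    letI : CommGroup H := IsCyclic.commGroup
    have := mul_comm (⟨h, hh⟩ : H) ⟨c, hCH hc⟩
    have hc' : h * c = c * h := by simpa using congrArg Subtype.val this
    rw [mul_assoc, ← hc', ← mul_assoc, inv_mul_cancel, one_mul]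
  -- right translation by `h` on `Q ⧸ C`
  let R : Q ⧸ C → Q ⧸ C := Quotient.map' (· * h) fun a b hab => by
    rw [QuotientGroup.leftRel_apply] at hab ⊢
    have hab' : (a * h)⁻¹ * (b * h) = h⁻¹ * (a⁻¹ * b) * h := by group
    rw [hab', hcomm _ hab]
    exact hab
  have hRmk : ∀ q : Q, R (q : Q ⧸ C) = ((q * h : Q) : Q ⧸ C) := fun q => rfl
  have hRi : ∀ i (q : Q), R^[i] (q : Q ⧸ C) = ((q * h ^ i : Q) : Q ⧸ C) := fun i => by
    induction i with
    | zero => intro q; rw [Function.iterate_zero_apply, pow_zero, mul_one]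
    | succ i ih => intro q; rw [Function.iterate_succ_apply', ih, hRmk, pow_succ, mul_assoc]
  let π : Q ⧸ C → Q ⧸ H := Subgroup.quotientMapOfLE hCH
  refine additive_funRepr_eq_smul_of_cycle σ π ?_ ?_ R ?_ ?_ ψ hψ hM ?_ ?_ ?_
  · -- `π` equivariant
    intro g x
    induction x using QuotientGroup.induction_on with
    | H q => rfl
  · -- `π` surjective
    intro y
    induction y using QuotientGroup.induction_on with
    | H q => exact ⟨(q : Q ⧸ C), rfl⟩
  · -- `R` equivariant
    intro g x
    induction x using QuotientGroup.induction_on with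
    | H q =>
      change R ((g * q : Q) : Q ⧸ C) = g • ((q * h : Q) : Q ⧸ C)
      rw [hRmk]
      change ((g * q * h : Q) : Q ⧸ C) = ((g * (q * h) : Q) : Q ⧸ C)
      rw [mul_assoc]
  · -- `π ∘ R = π`
    intro x
    induction x using QuotientGroup.induction_on with
    | H q =>
      rw [hRmk]
      change ((q * h : Q) : Q ⧸ H) = ((q : Q) : Q ⧸ H)
      rw [QuotientGroup.eq, mul_inv_rev, mul_assoc, inv_mul_cancel, mul_one]
      exact H.inv_mem hh
  · -- `R^[p] = id`
    intro x
    induction x using QuotientGroup.induction_on with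
    | H q =>
      rw [hRi, QuotientGroup.eq, mul_inv_rev, mul_assoc, inv_mul_cancel, mul_one]
      exact C.inv_mem hhp
  · -- fibres are `R`-orbits
    intro x x'
    induction x using QuotientGroup.induction_on with
    | H q =>
      induction x' using QuotientGroup.induction_on with
      | H q' =>
        intro hqq'
        have hmem : q⁻¹ * q' ∈ H := by
          have := hqq'
          change ((q : Q) : Q ⧸ H) = ((q' : Q) : Q ⧸ H) at this
          exact QuotientGroup.eq.1 this
        obtain ⟨i, c, hc, hic⟩ := hcos _ hmem
        refine ⟨i, ?_⟩
        rw [hRi, QuotientGroup.eq]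
        have hq' : q' = q * h ^ i * c := by rw [mul_assoc, ← hic, mul_inv_cancel_left]
        have : q'⁻¹ * (q * h ^ i) = c⁻¹ := by rw [hq']; group
        rw [this]
        exact C.inv_mem hc
  · -- no short cycles
    intro x i hi hip
    induction x using QuotientGroup.induction_on with
    | H q =>
      rw [hRi]
      intro heq
      apply hhi i hi hip
      have := QuotientGroup.eq.1 heq
      rwa [mul_inv_rev, mul_assoc, inv_mul_cancel, mul_one, inv_mem_iff] at this

end Coset

/-! ### §2. The tensor currency `M ⊗ ℤ[X]/p` of the lane -/

section Tensor

variable {M : Type} [AddCommGroup M] (σ : Representation ℤ Q M)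
variable (ψ : ∀ ⦃X : Type⦄ [AddCommGroup X] [Module ℤ X], Representation ℤ Q X → A)
  (hψ : ∀ ⦃X Y Z : Type⦄ [AddCommGroup X] [Module ℤ X] [AddCommGroup Y] [Module ℤ Y]
    [AddCommGroup Z] [Module ℤ Z] (ρX : Representation ℤ Q X) (ρY : Representation ℤ Q Y)
    (ρZ : Representation ℤ Q Z) (f : X →ₗ[ℤ] Y) (g : Y →ₗ[ℤ] Z),
    (∀ s x, f (ρX s x) = ρY s (f x)) → (∀ s y, g (ρY s y) = ρZ s (g y)) →
    Injective f → Surjective g → LinearMap.range f = LinearMap.ker g → Finite Y →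
    (∀ y : Y, (p : ℤ) • y = 0) → ψ ρY = ψ ρX + ψ ρZ)
include hψ

omit hp in
/-- **Tensor ↔ function currency**: `ψ (M ⊗ ℤ[X]/p) = ψ (Maps(X, M))` (diagonal actions), through
-w7 g9's `Representation.tprodPermQuotEquiv` (`m ⊗ [f] ↦ (x ↦ f(x) m)`).
[cite: MilneADT2006, I Lemma 5.4 (b)] [cite: SerreLinearRepresentations1977, §3.3] -/
theorem additive_tprod_permQuot_eq_funRepr [Finite M] (hM : ∀ m : M, (p : ℤ) • m = 0)
    (X : Type) [MulAction Q X] [Fintype X] :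
    ψ (σ.tprod (Representation.permQuot X p)) = ψ (funRepr σ X) := by
  obtain ⟨good_sub, good_quot, hψ'⟩ := StableLatticeReduction.Int.admissible ψ hψ
  have hpF : ∀ f : X → M, (p : ℤ) • f = 0 := fun f => funext fun x => hM (f x)
  exact Admissible.additive_eq_of_linearEquiv ψ _ good_quot hψ' _ _ ⟨inferInstance, hpF⟩
    (Representation.tprodPermQuotEquiv X p hM) (fun g t => by
      rw [Representation.tprodPermQuotEquiv_rep σ X p hM g t]; rfl)

/-- **The `p`-part step, tensor currency** (the form consumed by the lane's Artin assembly): for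
`C ≤ H ≤ Q` with `H` cyclic, `[H : C] = p`, and `M` a finite `ℤ[Q]`-module killed by `p`,
`ψ (M ⊗ ℤ[Q/C]/p) = p • ψ (M ⊗ ℤ[Q/H]/p)` (diagonal actions, `Representation.permQuot`).
[cite: MilneADT2006, I Lemma 2.10 (p. 32) and proof of Thm. 5.1 (p. 70)]
[cite: Serre1979, IX §1 Thm. 2, Corollary] -/
theorem additive_tprod_permQuot_eq_smul [Finite M] (hM : ∀ m : M, (p : ℤ) • m = 0)
    {C H : Subgroup Q} [Fintype (Q ⧸ C)] [Fintype (Q ⧸ H)] (hH : IsCyclic H) (hCH : C ≤ H)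
    (hidx : C.relIndex H = p) :
    ψ (σ.tprod (Representation.permQuot (Q ⧸ C) p)) =
      p • ψ (σ.tprod (Representation.permQuot (Q ⧸ H) p)) := by
  rw [additive_tprod_permQuot_eq_funRepr σ ψ hψ hM, additive_tprod_permQuot_eq_funRepr σ ψ hψ hM]
  exact additive_funRepr_quotient_eq_smul σ ψ hψ hM hH hCH hidx

end Tensor

end IndexPStep

end Literature.RepresentationTheory.FiniteGroups

end
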